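import Summits.FinalStateConjecture.FinalStateConjecture.Theorems.ExactKerrEndsSettlingAlongCensoredKerrEndsGaugeBorneUpgrade
import Literature.Geometry.Lorentzian.ExactKerrEnd
import HarnessLib

/-!
# Crux `SettlingAlongCensoredKerrEnds` (stmt-FinalStateConjecture-18520) FROM THE WALLS ALONE:
# `PW → SettlingAlongCensoredKerrEnds` (line `wall-cone-sections` with its gauge stub GU discharged)

Line `wall-cone-sections` (crux-strategist s2, `Cruxes/SettlingAlongCensoredKerrEnds/Lines/wall_cone_sections.lean`)
composes the crux C₂ from two stubs: GU (`stub_gaugeBorneUpgrade`, gauge-borne immersion/injectivity —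
PROVED, `Theorems/ExactKerrEndsSettlingAlongCensoredKerrEndsGaugeBorneUpgrade.lean`) and PW
(`stub_lipschitzWallsInKickUnfolding`, the physics: finitely many `K`-Lipschitz exceptional walls through
the corner of a one-sided kick-unfolding of the given censored Kerr-ended curve; open-problem sized,
member-local). This file lands the composition with GU discharged, so that the crux now rests on PW ALONE:

  `settlingAlongCensoredKerrEnds_of_lipschitzWalls : PW → Theses.ExactKerrEnds.SettlingAlongCensoredKerrEnds`

(PW displayed verbatim as the registered stub signature; the conclusion is the route decl BY NAME).
Proof = the strategist's composition, adapted (no definitions): along the given curve `F`, PW hands the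
unfolding `G`, the walls `g i` (all inside the cone `|s| ≤ K t`, `ray_ne_wall`) and the box; the ray
`s = (K + 1) t`, `t = t₂ x²/(1 + x²)` with `t₂ := min t₁ (b₀ / (2 (K + 1)))`, is a smooth parameter map
`ℝ¹ → ℝ²` vanishing at `0`, so `H c := G (ray c)` is a tame admissible curve through `F 0`
(`IsTameDataFamily.comp_contDiff`) whose members off `0` lie in the box off the walls, hence are
settled; GU (`stub_gaugeBorneUpgrade`) upgrades `H` to the injective immersed curve the crux asks for.

References: Christodoulou, CQG 16 (1999) A23, p. A24; Angelopoulos–Kehle–Unger arXiv:2603.10378, Thm 2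
(C¹ threshold walls in the model); Kehle–Unger arXiv:2402.10190, §1.4; Dafermos–Luk 2017, Conj. 1.
-/

-- the doubled `FinalStateConjecture.FinalStateConjecture` path component trips dupNamespace
set_option linter.dupNamespace false

noncomputable section

open Set Function Filter Topology TopologicalSpace
open scoped ENNReal NNReal Topology Manifold ContDiff

namespace Summit.FinalStateConjecture.FinalStateConjecture.Theorems.ExactKerrEnds

open Literature.Geometry.Lorentzian

namespace WallConeSections

/-! ### The cone ray over Lipschitz walls (proved real analysis; the corner map written out) -/

/-- The even corner reparametrisation `x ↦ t₂ · x² / (1 + x²)` is smooth. [folklore] -/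
theorem contDiff_corner (t₂ : ℝ) : ContDiff ℝ ∞ (fun x : ℝ ↦ t₂ * (x ^ 2 / (1 + x ^ 2))) := by
  refine contDiff_const.mul (ContDiff.div (contDiff_id.pow 2) (contDiff_const.add (contDiff_id.pow 2)) ?_)
  intro x
  positivity

/-- The corner map is positive off `0` (for `t₂ > 0`). [folklore] -/
theorem corner_pos {t₂ x : ℝ} (ht₂ : 0 < t₂) (hx : x ≠ 0) : 0 < t₂ * (x ^ 2 / (1 + x ^ 2)) := by
  have hx2 : 0 < x ^ 2 := by positivity
  positivity

/-- The corner map stays below `t₂` (for `t₂ > 0`). [folklore] -/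
theorem corner_lt {t₂ : ℝ} (ht₂ : 0 < t₂) (x : ℝ) : t₂ * (x ^ 2 / (1 + x ^ 2)) < t₂ := by
  have h1 : x ^ 2 / (1 + x ^ 2) < 1 := by
    rw [div_lt_one (by positivity)]
    linarith [sq_nonneg x]
  calc t₂ * (x ^ 2 / (1 + x ^ 2)) < t₂ * 1 := by exact mul_lt_mul_of_pos_left h1 ht₂
    _ = t₂ := mul_one t₂

/-- **Off the walls along the cone ray.** A `K`-Lipschitz function through the origin satisfies
`g t < (K + 1) t` for `t > 0`; so the ray `s = (K + 1) t` misses every such wall. [folklore] -/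
theorem ray_ne_wall {K : ℝ≥0} {g : ℝ → ℝ} (hg : LipschitzWith K g) (hg0 : g 0 = 0) {t : ℝ}
    (ht : 0 < t) : ((K : ℝ) + 1) * t ≠ g t := by
  have h := hg.dist_le_mul t 0
  rw [hg0, Real.dist_eq, Real.dist_eq, sub_zero, sub_zero, abs_of_pos ht] at h
  have h' : g t ≤ (K : ℝ) * t := le_trans (le_abs_self _) h
  intro heq
  have : ((K : ℝ) + 1) * t ≤ (K : ℝ) * t := heq ▸ h'
  nlinarith

end WallConeSections

open WallConeSections

/-! ### The composition: PW → C₂ (GU discharged) -/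

/-- **`SettlingAlongCensoredKerrEnds` from the Lipschitz-walls statement PW alone** (line
`wall-cone-sections` with its gauge stub GU proved, `stub_gaugeBorneUpgrade`): the hypothesis is the
registered stub `stub_lipschitzWallsInKickUnfolding` verbatim, the conclusion the route decl by name.
Along the given curve `F`, PW hands a tame admissible two-parameter unfolding `G` of `F`, finitely many
`K`-Lipschitz walls through the corner and a one-sided box whose members off the walls are settled; the
cone ray `s = (K + 1) t`, `t = t₂ x² / (1 + x²)`, misses the walls (`ray_ne_wall`), so `c ↦ G (ray c)` is
a tame admissible curve through `F 0` with settled members off `0` (`IsTameDataFamily.comp_contDiff`),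
and GU upgrades it to a tame, injective, immersed one. [cite: Christodoulou1999, p. A24] -/
theorem settlingAlongCensoredKerrEnds_of_lipschitzWalls :
    (∀ (X : Type) [TopologicalSpace X] [ChartedSpace E3 X] [IsManifold (𝓡 3) ∞ X] [T2Space X]
      [SecondCountableTopology X] [ConnectedSpace X],
      ∀ (e : AFEnd X) (F : EuclideanSpace ℝ (Fin 1) → InitialDataSet (𝓡 3) X),
        InitialDataSet.IsTameDataFamily e 1 F →
          ((InitialDataSet.IsImmersedAtZero 1 F ∧ Injective F) ∨ ∀ c, F c = F 0) →
            (∀ c, F c ∈ admissibleVacuumData X) →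
              (∀ c ≠ 0, (F c).HasExactKerrEnd ∧
                ∀ 𝒟 : VacuumCauchyDevelopment (F c), 𝒟.IsMaximal →
                  Summit.FinalStateConjecture.HasCompleteNullInfinity 𝒟.toCauchyDevelopment) →
                ∃ (e' : AFEnd X) (G : EuclideanSpace ℝ (Fin 2) → InitialDataSet (𝓡 3) X)
                  (n : ℕ) (g : Fin n → ℝ → ℝ) (K : ℝ≥0) (t₁ b₀ : ℝ),
                  InitialDataSet.IsTameDataFamily e' 2 G ∧
                    (∀ c : EuclideanSpace ℝ (Fin 1),
                      G ((c 0) • EuclideanSpace.single 0 (1 : ℝ) +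
                          (0 : ℝ) • EuclideanSpace.single 1 (1 : ℝ)) = F c) ∧
                    (∀ p, G p ∈ admissibleVacuumData X) ∧
                    (∀ i, LipschitzWith K (g i)) ∧ (∀ i, g i 0 = 0) ∧ 0 < t₁ ∧ 0 < b₀ ∧
                    ∀ t ∈ Ioc (0 : ℝ) t₁, ∀ s : ℝ, 0 < s → s < b₀ → (∀ i, s ≠ g i t) →
                      ∀ 𝒟 : VacuumCauchyDevelopment
                          (G (t • EuclideanSpace.single 0 (1 : ℝ) + s • EuclideanSpace.single 1 (1 : ℝ))),
                        𝒟.IsMaximal →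
                          Summit.FinalStateConjecture.HasCompleteNullInfinity 𝒟.toCauchyDevelopment ∧
                            ∃ (O : Set 𝒟.carrier) (d : FinalStateDecomposition 𝒟.toSpacetime O 2),
                              (∀ i, Kerr.IsSubextremal (d.mass i) (d.spin i)) ∧
                                O = Summit.FinalStateConjecture.exteriorOf 𝒟.toCauchyDevelopment
                                      d.charted ∧
                                  Summit.FinalStateConjecture.RaysStayInClosure
                                      𝒟.toCauchyDevelopment O ∧
                                    Summit.FinalStateConjecture.HasExhaustiveCharts d ∧
                                      Summit.FinalStateConjecture.IsFutureOriented d) →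
      Summit.FinalStateConjecture.FinalStateConjecture.Theses.ExactKerrEnds.SettlingAlongCensoredKerrEnds := by
  intro hPW
  have hGU := stub_gaugeBorneUpgrade
  intro X _ _ _ _ _ _ KerrEnded Censored Settled e F hF hdich h𝓓 hQ
  -- the members off `0` of `F` are Kerr-ended (legend = `HasExactKerrEnd`, definitionally) and censored
  have hQ' : ∀ c ≠ 0, (F c).HasExactKerrEnd ∧
      ∀ 𝒟 : VacuumCauchyDevelopment (F c), 𝒟.IsMaximal →
        Summit.FinalStateConjecture.HasCompleteNullInfinity 𝒟.toCauchyDevelopment := fun c hc ↦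
    ⟨(InitialDataSet.hasExactKerrEnd_iff (F c)).2 (hQ c hc).1, (hQ c hc).2⟩
  -- PW: the unfolding, the walls, the box
  obtain ⟨e', G, n, g, K, t₁, b₀, hG, hGF, hGadm, hg, hg0, ht₁, hb₀, hgood⟩ :=
    hPW X e F hF hdich h𝓓 hQ'
  -- the cone ray `s = (K+1) t`, `t = t₂ x²/(1+x²)`
  set κ : ℝ := (K : ℝ) + 1 with hκ
  have hκpos : 0 < κ := by rw [hκ]; positivity
  set t₂ : ℝ := min t₁ (b₀ / (2 * κ)) with ht₂
  have ht₂pos : 0 < t₂ := lt_min ht₁ (by positivity)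
  have ht₂le : t₂ ≤ t₁ := min_le_left _ _
  have ht₂b : κ * t₂ ≤ b₀ / 2 := by
    have : t₂ ≤ b₀ / (2 * κ) := min_le_right _ _
    calc κ * t₂ ≤ κ * (b₀ / (2 * κ)) := by exact mul_le_mul_of_nonneg_left this hκpos.le
      _ = b₀ / 2 := by field_simp
  let ray : EuclideanSpace ℝ (Fin 1) → EuclideanSpace ℝ (Fin 2) := fun c ↦
    (t₂ * ((c 0) ^ 2 / (1 + (c 0) ^ 2))) • EuclideanSpace.single 0 (1 : ℝ) +
      (κ * (t₂ * ((c 0) ^ 2 / (1 + (c 0) ^ 2)))) • EuclideanSpace.single 1 (1 : ℝ)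
  have h0 : ContDiff ℝ ∞ (fun c : EuclideanSpace ℝ (Fin 1) ↦ c 0) :=
    (EuclideanSpace.proj (0 : Fin 1) : EuclideanSpace ℝ (Fin 1) →L[ℝ] ℝ).contDiff
  have hφ : ContDiff ℝ ∞ (fun c : EuclideanSpace ℝ (Fin 1) ↦ t₂ * ((c 0) ^ 2 / (1 + (c 0) ^ 2))) :=
    (contDiff_corner t₂).comp h0
  have hray : ContDiff ℝ ∞ ray := (hφ.smul contDiff_const).add ((contDiff_const.mul hφ).smul contDiff_const)
  have hray0 : ray 0 = 0 := by
    simp [ray]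
  -- the handed-over (not yet immersed) curve
  let H : EuclideanSpace ℝ (Fin 1) → InitialDataSet (𝓡 3) X := fun c ↦ G (ray c)
  have hH : InitialDataSet.IsTameDataFamily e' 1 H := hG.comp_contDiff hray hray0
  have hH0 : H 0 = F 0 := by
    have h1 : H 0 = G 0 := by simp only [H, hray0]
    have h2 := hGF 0
    have h3 : ((0 : EuclideanSpace ℝ (Fin 1)) 0) • EuclideanSpace.single (0 : Fin 2) (1 : ℝ) +
        (0 : ℝ) • EuclideanSpace.single (1 : Fin 2) (1 : ℝ) = 0 := by simp
    rw [h3] at h2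
    exact h1.trans h2
  have hHadm : ∀ c, H c ∈ admissibleVacuumData X := fun c ↦ hGadm _
  have hHgood : ∀ c ≠ 0, ∀ 𝒟 : VacuumCauchyDevelopment (H c), 𝒟.IsMaximal →
      Summit.FinalStateConjecture.HasCompleteNullInfinity 𝒟.toCauchyDevelopment ∧
        ∃ (O : Set 𝒟.carrier) (d : FinalStateDecomposition 𝒟.toSpacetime O 2),
          (∀ i, Kerr.IsSubextremal (d.mass i) (d.spin i)) ∧
            O = Summit.FinalStateConjecture.exteriorOf 𝒟.toCauchyDevelopment d.charted ∧
              Summit.FinalStateConjecture.RaysStayInClosure 𝒟.toCauchyDevelopment O ∧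
                Summit.FinalStateConjecture.HasExhaustiveCharts d ∧
                  Summit.FinalStateConjecture.IsFutureOriented d := by
    intro c hc
    have hc0 : c 0 ≠ 0 := by
      intro h
      apply hc
      ext i
      rw [Subsingleton.elim i 0, h]
      rfl
    have htpos : 0 < t₂ * ((c 0) ^ 2 / (1 + (c 0) ^ 2)) := corner_pos ht₂pos hc0
    have htlt : t₂ * ((c 0) ^ 2 / (1 + (c 0) ^ 2)) < t₂ := corner_lt ht₂pos (c 0)
    have htmem : t₂ * ((c 0) ^ 2 / (1 + (c 0) ^ 2)) ∈ Ioc (0 : ℝ) t₁ := ⟨htpos, htlt.le.trans ht₂le⟩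
    have hspos : 0 < κ * (t₂ * ((c 0) ^ 2 / (1 + (c 0) ^ 2))) := mul_pos hκpos htpos
    have hslt : κ * (t₂ * ((c 0) ^ 2 / (1 + (c 0) ^ 2))) < b₀ := by
      have : κ * (t₂ * ((c 0) ^ 2 / (1 + (c 0) ^ 2))) < κ * t₂ := mul_lt_mul_of_pos_left htlt hκpos
      linarith
    have hsoff : ∀ i, κ * (t₂ * ((c 0) ^ 2 / (1 + (c 0) ^ 2))) ≠
        g i (t₂ * ((c 0) ^ 2 / (1 + (c 0) ^ 2))) := fun i ↦
      ray_ne_wall (hg i) (hg0 i) htpos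
    exact hgood _ htmem _ hspos hslt hsoff
  -- GU: immersion and injectivity are gauge-borne
  obtain ⟨e'', F', hF', hF'0, hinj, himm, hadm', hgood'⟩ := hGU X e' H hH hHadm hHgood
  exact ⟨e'', F', hF', hF'0.trans hH0, hinj, himm, hadm', fun c hc ↦ hgood' c hc⟩

end Summit.FinalStateConjecture.FinalStateConjecture.Theorems.ExactKerrEnds

end
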